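import Summits.QuantumFields.YangMills.Theorems.FluctuationComparisonRegPrIntLS2BetaStageAxialCombReading
import Literature.MathematicalPhysics.QuantumFieldTheory.Balaban1983to89.B7Prop9General
import HarnessLib

/-!
# S2β · AVG₂♭-ax_q road, step (4) companion — THE TREE-COMB BOND STEP: which bonds LIE ON the one-level comb `Γ_{emb y, x}` of lit `axialT`, and the
# discharge of ✓`bond_eq_of_axial`'s field-universal binder `W(Γ_{y, x+e_μ}) = W(Γ_{y,x})·W⟨x,μ⟩` for them

Cell `ym3-torus` (YM ladder rung R3 = continuum `SU(2)` Yang–Mills on the three-torus at fixed lattice data — a RUNG: NOT d = 4, NOT infinite volume, NOT a mass gap,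
NOT Clay).  Width seat «width 17» `ym3-torus-px17` (gen 22); crux `stmt-QuantumFields-20520` (`…Theses.UnitScaleTilt.FluctuationComparisonRegPrIntL`), LINE g18-1 S2β,
AVG₂♭-ax_q with `Ax := AxStage` (UV3-NODE §89.2∕§89.7 (4)).  `--kind proof --supports stmt-QuantumFields-20520 --as helper`, count-neutral, DEFINITION-FREE (0 `def`,
0 `instance`, 0 `notation`, 0 `sorry`, default heartbeats); generic `Params`, ANY group.

WHY.  px17 g19 ✓`…S2BetaStageGaugeTower.bond_eq_of_axial` and px17 g22's «stage-axial comb reading» (`…S2BetaStageAxialCombReading` §3) read the relative field of two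
comb-axial configurations ON A COMB BOND under the binder «`∀ W, axialT W (emb y) (x+e_μ) = axialT W (emb y) x · W⟨x,μ⟩`» — a purely GEOMETRIC statement («the bond
`⟨x, μ⟩` lies on the tree contour from the block centre»), left abstract there.  THIS FILE names the comb bonds of lit `B10Eq27TorusAxialLog.axialT`'s convention (B5's tree
contour `treeWord`, axes in the order `d−1, …, 0`, `valMinAbs` steps from the centre `emb y`): **`⟨x, μ⟩` is a comb bond iff the relative position `x − emb y` has ZERO
components in every direction `ν < μ`** (the directions the contour changes AFTER `μ`), and discharges the binder for them — for EITHER sign of `(x − emb y)_μ` (on the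
negative half-axis the contour to `x` passes through `x + e_μ` first and the identity follows by cancellation).

WHAT IS PROVED (sorry-free).
§1 `ℤ^d` words ([folklore] list algebra over lit `B7Prop9General.treeWord_split`): `loPart_eq_zero_of_lo`, `hiPart_add_e`, `loPart_add_e`, `treeWord_of_lo`
   (`treeWord v = treeWord (hiPart μ v) ++ seg μ (v μ)` when the low part vanishes), ★`treeWord_add_e_of_lo_nonneg` (`v_μ ≥ 0`: `treeWord (v + e_μ) = treeWord v ++ [(μ,+)]`),
   ★`treeWord_of_lo_neg` (`v_μ < 0`: `treeWord v = treeWord (v + e_μ) ++ [(μ,−)]`).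
§2 torus ([folklore] over lit `holT_append`, `rel_shift_of_le`): ★★`axialT_shift_eq_mul_of_treeComb` — for `x` with `(x − y)_ν = 0` (`ν < μ`) and no wrap-around at `μ`:
   `axialT V y (x+e_μ) = axialT V y x · V⟨x,μ⟩` for EVERY configuration `V` (any group).
§3 blocks: ★★`axialT_emb_shift_eq_mul` — the same from the centre `emb (blockOf x)` with the no-wrap discharged by ✓`noWrap_emb` (`j + 1 ≤ m + K`): the binder of
   ✓`bond_eq_of_axial` ∕ `…StageAxialCombReading` §3 HOLDS on every tree-comb bond of a one-level block.
§4 THE KNIT with ✓p828013 `…StageAxialCombReading` §3 (hypotheses = the (T4) clause texts of `AxStage` + `hlo` + `blockOf (x+e_μ) = blockOf x`): ★★`stageField_treeComb_eq_lift`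
   (`U′_j ⟨x,μ⟩ = V_j ⟨x,μ⟩`), ★★`stageChord_treeComb_eq_liftChord` (lower stages: the LIFTED chord), ★★★`stageChord_treeComb_eq_one_of_top` ∕ `stageChord_treeComb_top` (top stage:
   the two tower fields AGREE ∕ chord `= 1` on every tree-comb bond — §89.4 (G-axial) exact there, px20 g23's class (T)).

HONEST SCOPE.  Lattice-word bookkeeping; nothing of Bałaban's analysis is asserted or proved ([Balaban1985Averaging] p.24 `Γ_{y,x}`, (58) p.27; [Balaban1984PropagatorsI]
(1.7) p.18 are the printed contour conventions); AVG₂♭-ax_q, (D-ax), h3 HYPOTHESES; GAP♯∘ (`stub_uniformFibreGapOrbit`, registry 3732b7df UNTOUCHED), S2β, the five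
registered stubs (0∕5), 20520, 19936, 19200, `YM3TorusSU2` are NOT proved; rung R3 — NOT d = 4, NOT infinite volume, NOT a mass gap, NOT Clay.
-/

set_option autoImplicit false

namespace Summit.QuantumFields.YangMills.Theorems.FluctuationComparisonRegPrIntLS2BetaTreeCombBondStep

open Literature.MathematicalPhysics.QuantumFieldTheory.Balaban1983to89
open T4Continuum
open B10Eq27TorusAxialLog (transl rel holT axialT transl_apply transl_add transl_add_e transl_rel rel_apply rel_shift_of_le holT_append holT_cons_true
  holT_cons_false holT_nil transl_disp_treeWord_rel)
open B7Prop1Explicit (treeWord e e_apply seg seg_natCast seg_zero seg_neg_natCast disp disp_treeWord treeWord_zero)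
open B7Prop9General (hiPart loPart treeWord_split)
open Summit.QuantumFields.YangMills.Theorems.FluctuationComparisonRegPrIntLS2BetaIterAxialGaugeOneLevel (noWrap_emb)
open Summit.QuantumFields.YangMills.Theorems.FluctuationComparisonRegPrIntLS2BetaStageAxialCombReading
  (stageField_comb_eq_lift stageChord_comb_eq_liftChord stageChord_comb_eq_one_of_top stageChord_comb_top)

/-! ## §1 `ℤ^d` words: the tree contour of `v + e_μ` when the low part of `v` vanishes -/

section Words

variable {d : ℕ}

/-- If `v_ν = 0` for every `ν < μ` then `loPart μ v = 0`. [folklore] -/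
theorem loPart_eq_zero_of_lo (μ : Fin d) (v : B7Prop1Explicit.Site d) (hlo : ∀ ν, ν < μ → v ν = 0) : loPart μ v = 0 := by
  funext κ
  by_cases h : κ < μ
  · simp [loPart, h, hlo κ h]
  · simp [loPart, h]

/-- `hiPart μ (v + e_μ) = hiPart μ v`. [folklore] -/
theorem hiPart_add_e (μ : Fin d) (v : B7Prop1Explicit.Site d) : hiPart μ (v + e μ) = hiPart μ v := by
  funext κ
  by_cases h : μ < κ
  · simp [hiPart, h, e_apply, ne_of_gt h]
  · simp [hiPart, h]

/-- `loPart μ (v + e_μ) = loPart μ v`. [folklore] -/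
theorem loPart_add_e (μ : Fin d) (v : B7Prop1Explicit.Site d) : loPart μ (v + e μ) = loPart μ v := by
  funext κ
  by_cases h : κ < μ
  · simp [loPart, h, e_apply, ne_of_lt h]
  · simp [loPart, h]

/-- `(v + e_μ)_μ = v_μ + 1`. [folklore] -/
theorem add_e_apply_self (μ : Fin d) (v : B7Prop1Explicit.Site d) : (v + e μ) μ = v μ + 1 := by
  simp [e_apply]

/-- With vanishing low part the tree contour is `Γ(hiPart) ∪ (segment of v_μ steps e_μ)`. [cite: Balaban1985Averaging, p.24; Balaban1984PropagatorsI, (1.7) p.18] -/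
theorem treeWord_of_lo (μ : Fin d) (v : B7Prop1Explicit.Site d) (hlo : ∀ ν, ν < μ → v ν = 0) :
    treeWord v = treeWord (hiPart μ v) ++ seg μ (v μ) := by
  rw [treeWord_split μ v, loPart_eq_zero_of_lo μ v hlo, treeWord_zero, List.append_nil]

/-- ★ **FORWARD COMB BOND**: `v_ν = 0` (`ν < μ`) and `0 ≤ v_μ` ⟹ `Γ(v + e_μ) = Γ(v) ∪ [+e_μ]`. [cite: Balaban1985Averaging, p.24; Balaban1984PropagatorsI, (1.7) p.18] -/
theorem treeWord_add_e_of_lo_nonneg (μ : Fin d) (v : B7Prop1Explicit.Site d) (hlo : ∀ ν, ν < μ → v ν = 0) (hμ : 0 ≤ v μ) :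
    treeWord (v + e μ) = treeWord v ++ [(μ, true)] := by
  have hlo' : ∀ ν, ν < μ → (v + e μ) ν = 0 := fun ν hν => by
    rw [Pi.add_apply, hlo ν hν, e_apply, if_neg (ne_of_lt hν), add_zero]
  rw [treeWord_of_lo μ (v + e μ) hlo', treeWord_of_lo μ v hlo, hiPart_add_e, add_e_apply_self, List.append_assoc]
  congr 1
  obtain ⟨n, hn⟩ := Int.eq_ofNat_of_zero_le hμ
  rw [hn, show (n : ℤ) + 1 = ((n + 1 : ℕ) : ℤ) by push_cast; ring, seg_natCast, seg_natCast, List.replicate_succ']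

/-- ★ **BACKWARD COMB BOND**: `v_ν = 0` (`ν < μ`) and `v_μ < 0` ⟹ `Γ(v) = Γ(v + e_μ) ∪ [−e_μ]` (the contour to `v` passes through `v + e_μ` first).
[cite: Balaban1985Averaging, p.24; Balaban1984PropagatorsI, (1.7) p.18] -/
theorem treeWord_of_lo_neg (μ : Fin d) (v : B7Prop1Explicit.Site d) (hlo : ∀ ν, ν < μ → v ν = 0) (hμ : v μ < 0) :
    treeWord v = treeWord (v + e μ) ++ [(μ, false)] := by
  have hlo' : ∀ ν, ν < μ → (v + e μ) ν = 0 := fun ν hν => by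
    rw [Pi.add_apply, hlo ν hν, e_apply, if_neg (ne_of_lt hν), add_zero]
  rw [treeWord_of_lo μ (v + e μ) hlo', treeWord_of_lo μ v hlo, hiPart_add_e, add_e_apply_self, List.append_assoc]
  congr 1
  obtain ⟨n, hn⟩ := Int.exists_eq_neg_ofNat (le_of_lt hμ)
  have hn0 : n ≠ 0 := by rintro rfl; simp [hn] at hμ
  obtain ⟨k, rfl⟩ := Nat.exists_eq_succ_of_ne_zero hn0
  rw [hn, show -((k.succ : ℕ) : ℤ) + 1 = -((k : ℕ) : ℤ) by push_cast; ring, seg_neg_natCast, seg_neg_natCast, Nat.succ_eq_add_one,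
    List.replicate_succ']

end Words

/-! ## §2 Torus: the comb transport steps across a comb bond -/

section Torus

variable {P : Params} {j : ℕ} {G : Type*} [Group G]

/-- The shifted site as a translate: `x + e_μ = y + ((x − y) + e_μ)`. [folklore] -/
theorem shift_eq_transl_rel_add_e (y x : Site P j) (μ : Fin P.d) : x.shift μ = transl y (rel y x + e μ) := by
  rw [transl_add_e, transl_rel]

/-- ★★ **THE COMB TRANSPORT STEPS ACROSS A COMB BOND**: if `(x − y)_ν = 0` for every `ν < μ` (the bond `⟨x, μ⟩` lies on the tree contour from `y`, either half-axis)
and there is no wrap-around at `μ`, then `V(Γ_{y, x+e_μ}) = V(Γ_{y,x})·V⟨x,μ⟩` for EVERY configuration `V` — the binder of ✓`bond_eq_of_axial`.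
[cite: Balaban1985Averaging, (9) p.18, p.24; Balaban1985RegularSpaces, (1.19) p.79] -/
theorem axialT_shift_eq_mul_of_treeComb (V : GaugeField P j G) (y x : Site P j) (μ : Fin P.d)
    (hlo : ∀ ν, ν < μ → rel y x ν = 0) (hwrap : (rel y x μ + 1) * 2 ≤ (P.sitesPerDir j : ℤ)) :
    axialT V y (x.shift μ) = axialT V y x * V ⟨x, μ⟩ := by
  unfold axialT
  rw [rel_shift_of_le y x μ hwrap]
  rcases le_or_gt 0 (rel y x μ) with hμ | hμ
  · -- forward: `Γ(v + e_μ) = Γ(v) ++ [+e_μ]`, the last letter read from `y + v = x`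
    rw [treeWord_add_e_of_lo_nonneg μ (rel y x) hlo hμ, holT_append, transl_disp_treeWord_rel, holT_cons_true, holT_nil, mul_one]
  · -- backward: `Γ(v) = Γ(v + e_μ) ++ [−e_μ]`, the last letter read from `y + (v + e_μ) = x + e_μ`
    rw [treeWord_of_lo_neg μ (rel y x) hlo hμ, holT_append, disp_treeWord, ← shift_eq_transl_rel_add_e, holT_cons_false, holT_nil, mul_one,
      B10StarCount.unshift_shift, inv_mul_cancel_right]

end Torus

/-! ## §3 Blocks: the binder of `bond_eq_of_axial` holds on every tree-comb bond of a one-level block -/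

section Block

variable {P : Params} {j : ℕ} {G : Type*} [Group G]

/-- ★★ **ON A TREE-COMB BOND OF A BLOCK THE BINDER HOLDS**: for a site `x` whose relative position from its block centre has zero components in the directions
`ν < μ` (standing range `j + 1 ≤ m + K`, so the comb does not wrap — ✓`noWrap_emb`): `W(Γ_{emb(blockOf x), x+e_μ}) = W(Γ_{emb(blockOf x), x})·W⟨x,μ⟩` for EVERY `W`.
[cite: Balaban1985Averaging, p.24, (58) p.27; Balaban1985RegularSpaces, (1.19) p.79; Balaban1987RG1, (0.1)-(0.3) p.252] -/
theorem axialT_emb_shift_eq_mul (hj : j + 1 ≤ P.m + P.K) (x : Site P j) (μ : Fin P.d)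
    (hlo : ∀ ν, ν < μ → rel (emb (blockOf x)) x ν = 0) (W : GaugeField P j G) :
    axialT W (emb (blockOf x)) (x.shift μ) = axialT W (emb (blockOf x)) x * W ⟨x, μ⟩ :=
  axialT_shift_eq_mul_of_treeComb W (emb (blockOf x)) x μ hlo (noWrap_emb hj rfl μ)

/-- The binder in the field-universal form consumed by ✓`bond_eq_of_axial` ∕ `…StageAxialCombReading` §3. [cite: Balaban1985RegularSpaces, (1.19) p.79] -/
theorem treeComb_binder (hj : j + 1 ≤ P.m + P.K) (x : Site P j) (μ : Fin P.d)
    (hlo : ∀ ν, ν < μ → rel (emb (blockOf x)) x ν = 0) :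
    ∀ W : GaugeField P j G, axialT W (emb (blockOf x)) (x.shift μ) = axialT W (emb (blockOf x)) x * W ⟨x, μ⟩ :=
  fun W => axialT_emb_shift_eq_mul hj x μ hlo W

end Block

/-! ## §4 The knit with `…StageAxialCombReading` §3: the `AxStage` readings on tree-comb bonds, binder discharged -/

section Knit

variable {P : Params} {G : Type*} [GaugeGroup G]

/-- ★★ **ON A TREE-COMB BOND THE STAGE FIELD IS THE LIFT** ((T4) at stage `j`; `(x − emb y)_ν = 0` for `ν < μ`; `x + e_μ` in the same block; `j + 1 ≤ m + K`).
[cite: Balaban1985RegularSpaces, (1.19) p.79; Balaban1985Averaging, (58) p.27] -/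
theorem stageField_treeComb_eq_lift (av : ∀ i, Averaging P i G) {j : ℕ} (hj : j + 1 ≤ P.m + P.K)
    (lift : (i : ℕ) → GaugeField P (i + 1) G → GaugeField P i G) (g : (i : ℕ) → Site P i → G) (U : GaugeField P 0 G)
    (hT4 : ∀ x, axialT (GaugeField.gaugeAct (g j) (Averaging.iter av j U)) (emb (blockOf x)) x =
      axialT (lift j (GaugeField.gaugeAct (g (j + 1)) (Averaging.iter av (j + 1) U))) (emb (blockOf x)) x)
    (x : Site P j) (μ : Fin P.d) (hblk : blockOf (x.shift μ) = blockOf x) (hlo : ∀ ν, ν < μ → rel (emb (blockOf x)) x ν = 0) :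
    GaugeField.gaugeAct (g j) (Averaging.iter av j U) ⟨x, μ⟩ = lift j (GaugeField.gaugeAct (g (j + 1)) (Averaging.iter av (j + 1) U)) ⟨x, μ⟩ :=
  stageField_comb_eq_lift av lift g U hT4 x μ hblk (treeComb_binder hj x μ hlo)

/-- ★★ **ON A TREE-COMB BOND THE CHORD OF THE TWO TOWERS IS THE LIFTED COARSE CHORD** (lower stages: NOT `1`).
[cite: Balaban1985RegularSpaces, (1.19) p.79; Balaban1985Variational, (16)-(18) p.280] -/
theorem stageChord_treeComb_eq_liftChord (av : ∀ i, Averaging P i G) {j : ℕ} (hj : j + 1 ≤ P.m + P.K)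
    (lift : (i : ℕ) → GaugeField P (i + 1) G → GaugeField P i G) (g g₀ : (i : ℕ) → Site P i → G) (U U₁ : GaugeField P 0 G)
    (hT4 : ∀ x, axialT (GaugeField.gaugeAct (g j) (Averaging.iter av j U)) (emb (blockOf x)) x =
      axialT (lift j (GaugeField.gaugeAct (g (j + 1)) (Averaging.iter av (j + 1) U))) (emb (blockOf x)) x)
    (hT4' : ∀ x, axialT (GaugeField.gaugeAct (g₀ j) (Averaging.iter av j U₁)) (emb (blockOf x)) x =
      axialT (lift j (GaugeField.gaugeAct (g₀ (j + 1)) (Averaging.iter av (j + 1) U₁))) (emb (blockOf x)) x)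
    (x : Site P j) (μ : Fin P.d) (hblk : blockOf (x.shift μ) = blockOf x) (hlo : ∀ ν, ν < μ → rel (emb (blockOf x)) x ν = 0) :
    GaugeField.gaugeAct (g j) (Averaging.iter av j U) ⟨x, μ⟩ * (GaugeField.gaugeAct (g₀ j) (Averaging.iter av j U₁) ⟨x, μ⟩)⁻¹ =
      lift j (GaugeField.gaugeAct (g (j + 1)) (Averaging.iter av (j + 1) U)) ⟨x, μ⟩ *
        (lift j (GaugeField.gaugeAct (g₀ (j + 1)) (Averaging.iter av (j + 1) U₁)) ⟨x, μ⟩)⁻¹ :=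
  stageChord_comb_eq_liftChord av lift g g₀ U U₁ hT4 hT4' x μ hblk (treeComb_binder hj x μ hlo)

/-- ★★★ **TOP STAGE: THE TWO TOWER FIELDS AGREE ON EVERY TREE-COMB BOND** (`U′_{j+1} = U₁′_{j+1}` — fibre mates, `g_{j+1} ≡ 1 ≡ g₀_{j+1}`,
✓`stageField_top_eq`): the (G-axial) gain of UV3-NODE §89.4, EXACT at the top stage, binder discharged. [cite: Balaban1985Averaging, (58) p.27; Balaban1985RegularSpaces, (1.19) p.79] -/
theorem stageChord_treeComb_eq_one_of_top (av : ∀ i, Averaging P i G) {j : ℕ} (hj : j + 1 ≤ P.m + P.K)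
    (lift : (i : ℕ) → GaugeField P (i + 1) G → GaugeField P i G) (g g₀ : (i : ℕ) → Site P i → G) (U U₁ : GaugeField P 0 G)
    (hT4 : ∀ x, axialT (GaugeField.gaugeAct (g j) (Averaging.iter av j U)) (emb (blockOf x)) x =
      axialT (lift j (GaugeField.gaugeAct (g (j + 1)) (Averaging.iter av (j + 1) U))) (emb (blockOf x)) x)
    (hT4' : ∀ x, axialT (GaugeField.gaugeAct (g₀ j) (Averaging.iter av j U₁)) (emb (blockOf x)) x =
      axialT (lift j (GaugeField.gaugeAct (g₀ (j + 1)) (Averaging.iter av (j + 1) U₁))) (emb (blockOf x)) x)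
    (htop : GaugeField.gaugeAct (g (j + 1)) (Averaging.iter av (j + 1) U) = GaugeField.gaugeAct (g₀ (j + 1)) (Averaging.iter av (j + 1) U₁))
    (x : Site P j) (μ : Fin P.d) (hblk : blockOf (x.shift μ) = blockOf x) (hlo : ∀ ν, ν < μ → rel (emb (blockOf x)) x ν = 0) :
    GaugeField.gaugeAct (g j) (Averaging.iter av j U) ⟨x, μ⟩ = GaugeField.gaugeAct (g₀ j) (Averaging.iter av j U₁) ⟨x, μ⟩ :=
  stageChord_comb_eq_one_of_top av lift g g₀ U U₁ hT4 hT4' htop x μ hblk (treeComb_binder hj x μ hlo)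

/-- The same in chord form: `U′_j b·(U₁′_j b)⁻¹ = 1` on top-stage tree-comb bonds. [cite: Balaban1985Averaging, (58) p.27] -/
theorem stageChord_treeComb_top (av : ∀ i, Averaging P i G) {j : ℕ} (hj : j + 1 ≤ P.m + P.K)
    (lift : (i : ℕ) → GaugeField P (i + 1) G → GaugeField P i G) (g g₀ : (i : ℕ) → Site P i → G) (U U₁ : GaugeField P 0 G)
    (hT4 : ∀ x, axialT (GaugeField.gaugeAct (g j) (Averaging.iter av j U)) (emb (blockOf x)) x =
      axialT (lift j (GaugeField.gaugeAct (g (j + 1)) (Averaging.iter av (j + 1) U))) (emb (blockOf x)) x)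
    (hT4' : ∀ x, axialT (GaugeField.gaugeAct (g₀ j) (Averaging.iter av j U₁)) (emb (blockOf x)) x =
      axialT (lift j (GaugeField.gaugeAct (g₀ (j + 1)) (Averaging.iter av (j + 1) U₁))) (emb (blockOf x)) x)
    (htop : GaugeField.gaugeAct (g (j + 1)) (Averaging.iter av (j + 1) U) = GaugeField.gaugeAct (g₀ (j + 1)) (Averaging.iter av (j + 1) U₁))
    (x : Site P j) (μ : Fin P.d) (hblk : blockOf (x.shift μ) = blockOf x) (hlo : ∀ ν, ν < μ → rel (emb (blockOf x)) x ν = 0) :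
    GaugeField.gaugeAct (g j) (Averaging.iter av j U) ⟨x, μ⟩ * (GaugeField.gaugeAct (g₀ j) (Averaging.iter av j U₁) ⟨x, μ⟩)⁻¹ = 1 :=
  stageChord_comb_top av lift g g₀ U U₁ hT4 hT4' htop x μ hblk (treeComb_binder hj x μ hlo)

end Knit

end Summit.QuantumFields.YangMills.Theorems.FluctuationComparisonRegPrIntLS2BetaTreeCombBondStep
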